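import Summits.MatrixMultiplication.OmegaCensus.SmallFormats.InvertiblePointNearPruneUnionCaps
import HarnessLib

/-!
# ω-census family (a): K-equivariance of the near-stage prune system — TUPLE-LINEAR CAPS and the Q̃-MODE (second supplement to p529277)

Cell `pub-omega` (unit `pub-omega-eng1-g29`, ENG1), topic `Summits/MatrixMultiplication/OmegaCensus` (sub-folder `SmallFormats`).
Framing (verbatim): lottery ticket; floor = certified bounds/negative ranges. HONEST FRAMING: the same elementary transport-of-structure as p529277 /
`InvertiblePointNearPruneUnionCaps`, in the most general shape the near-stage engines use. The tensor engine's Q̃-MODE (`ipdfs3`, EQUIVARIANCE.md §1) adds ONE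
MORE UNKNOWN `Q̃ ∈ {W ∈ W_τ : ω(W) = 1}` (an AFFINE list, not part of the independence requirement) and z-caps on vectors `fp_s(X)·W_s − κ_s d_s(X)·Q̃` that are
linear in the PAIR `(W_s, Q̃)` — not in one unknown —, so that system is not literally a `PruneSolU`. Here (§1) the unknown is the whole tuple `W : ι → V` constrained by
an ARBITRARY set `𝓛 ⊆ V^ι`, linear independence is asked of a sub-family `W ∘ emb`, and every cap vector is an arbitrary LINEAR function of the tuple:
`dim (Q a ⊔ span {T a j W : j ∈ κ a}) ≤ cap a` (`TupleSol`). Transport along a linear automorphism `e` of `V` (acting componentwise, `LinearEquiv.piCongrRight`) with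
`𝓛' = e∘𝓛`, `T' a j (e ∘ W) = e_a (T a j W)`, `Q' a = e_a(Q a)` preserves solvability (`TupleSol.transport`, `tupleSol_iff_of_linearEquiv`). §2: for `V = k^{m×n}` and
`e = (· g)`, every TUPLE-STACKED LEFT MULTIPLICATION `W ↦ (∑_s M i s · W s)_i` (`tupleStackLeftMul`; the z-cap vectors above are of this form with scalar matrices for the
`Q̃`-coefficient) commutes with `e` (`tupleStackLeftMul_mul_right`), whence `matTupleSol_iff_image_mul_right`. §3: the ω-dependent tuple lists of the Q̃-mode —
ω-filtered footprint lists (p529277 `omegaList`) on the terms and the affine list `{Q ∈ P : ω(Q) = 1}` on `Q̃` — satisfy `(𝓛(ω ∘ (· g)))·g = 𝓛(ω)` for invertible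
`g ∈ Stab(P)` (`image_mulRight_omegaTupleList`), so `SOL(ω) ⇔ SOL(ω ∘ (· g))` holds for the Q̃-mode system as well (`omegaTupleSol_iff_comp_mulRight`). With p529277 +
`…UnionCaps` + this file, every constraint shape named in EQUIVARIANCE.md §1–§4 / RESULT-fp5 §3 is a literal instance. Outside Lean as before: the transcription fact, run-time
checks of the sampled `g`, node counts, time-outs. Nothing here is a bound on a rank or on `ω` the exponent.
-/

namespace Summit.MatrixMultiplication.OmegaCensus.SmallFormats

open Module Matrix

/-! ## §1 Tuple-level systems -/

section Tuple

variable {k : Type*} [Field k] {V : Type*} [AddCommGroup V] [Module k V]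
  {ι ι₀ : Type*} {A : Type*} {κ : A → Type*} {U : A → Type*} [∀ a, AddCommGroup (U a)] [∀ a, Module k (U a)]

/-- **Tuple-level solvability.** `TupleSol 𝓛 emb T Q cap`: some tuple `W ∈ 𝓛` has `W ∘ emb` linearly independent and obeys every cap
`dim (Q a ⊔ span {T a j W : j ∈ κ a}) ≤ cap a`, the cap vectors being arbitrary linear functions of the whole tuple. -/
def TupleSol (𝓛 : Set (ι → V)) (emb : ι₀ → ι) (T : (a : A) → κ a → ((ι → V) →ₗ[k] U a))
    (Q : (a : A) → Submodule k (U a)) (cap : A → ℕ) : Prop :=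
  ∃ W ∈ 𝓛, LinearIndependent k (W ∘ emb) ∧
    ∀ a, finrank k ↥(Q a ⊔ Submodule.span k (Set.range fun j => T a j W)) ≤ cap a

/-- **Transport of tuple witnesses** along `e` acting componentwise. -/
theorem TupleSol.transport (e : V ≃ₗ[k] V) (eU : ∀ a, U a ≃ₗ[k] U a)
    {𝓛 𝓛' : Set (ι → V)} (h𝓛 : 𝓛' = (fun W : ι → V => fun s => e (W s)) '' 𝓛) (emb : ι₀ → ι)
    {T T' : (a : A) → κ a → ((ι → V) →ₗ[k] U a)} (hT : ∀ a j (W : ι → V), T' a j (fun s => e (W s)) = eU a (T a j W))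
    {Q Q' : (a : A) → Submodule k (U a)} (hQ : ∀ a, Q' a = (Q a).map (eU a : U a →ₗ[k] U a)) {cap : A → ℕ}
    (h : TupleSol 𝓛 emb T Q cap) : TupleSol 𝓛' emb T' Q' cap := by
  obtain ⟨W, hW𝓛, hWind, hWcap⟩ := h
  refine ⟨fun s => e (W s), ?_, ?_, ?_⟩
  · rw [h𝓛]; exact ⟨W, hW𝓛, rfl⟩
  · exact hWind.map' (e : V →ₗ[k] V) e.ker
  · intro a
    have hfam : (fun j => T' a j (fun s => e (W s))) = fun j => eU a (T a j W) := by
      funext j; exact hT a j W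
    rw [hfam, hQ a, finrank_sup_span_range_comp_equiv (eU a) (Q a) (fun j => T a j W)]
    exact hWcap a

/-- **Tuple-level solvability is invariant under transport.** -/
theorem tupleSol_iff_of_linearEquiv (e : V ≃ₗ[k] V) (eU : ∀ a, U a ≃ₗ[k] U a)
    {𝓛 𝓛' : Set (ι → V)} (h𝓛 : 𝓛' = (fun W : ι → V => fun s => e (W s)) '' 𝓛) (emb : ι₀ → ι)
    {T T' : (a : A) → κ a → ((ι → V) →ₗ[k] U a)} (hT : ∀ a j (W : ι → V), T' a j (fun s => e (W s)) = eU a (T a j W))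
    {Q Q' : (a : A) → Submodule k (U a)} (hQ : ∀ a, Q' a = (Q a).map (eU a : U a →ₗ[k] U a)) (cap : A → ℕ) :
    TupleSol 𝓛 emb T Q cap ↔ TupleSol 𝓛' emb T' Q' cap := by
  constructor
  · exact TupleSol.transport e eU h𝓛 emb hT hQ
  · refine TupleSol.transport e.symm (fun a => (eU a).symm) ?_ emb ?_ ?_
    · rw [h𝓛, ← Set.image_comp]
      ext W
      simp only [Function.comp_def, LinearEquiv.symm_apply_apply, Set.image_id']
    · intro a j W
      have h := hT a j (fun s => e.symm (W s))
      simp only [LinearEquiv.apply_symm_apply] at h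
      rw [h, LinearEquiv.symm_apply_apply]
    · intro a
      rw [hQ a, ← Submodule.map_comp]
      ext x; simp

/-- Shrinking the tuple set can only destroy witnesses. -/
theorem TupleSol.mono {𝓛 𝓛' : Set (ι → V)} (h𝓛 : 𝓛' ⊆ 𝓛) {emb : ι₀ → ι} {T : (a : A) → κ a → ((ι → V) →ₗ[k] U a)}
    {Q : (a : A) → Submodule k (U a)} {cap : A → ℕ} (h : TupleSol 𝓛' emb T Q cap) : TupleSol 𝓛 emb T Q cap := by
  obtain ⟨W, hW𝓛, hWind, hWcap⟩ := h
  exact ⟨W, h𝓛 hW𝓛, hWind, hWcap⟩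

end Tuple

/-! ## §2 The matrix instance: componentwise right multiplication, tuple-stacked left multiplications -/

section MatrixTuple

variable {k : Type*} [Field k] {m n : ℕ}

/-- A TUPLE-STACKED LEFT MULTIPLICATION `W ↦ (∑_s M i s · W s)_{i < p}` (e.g. the Q̃-mode z-cap vectors `fp_s(X)·W_s − κ_s d_s(X)·Q̃`, with a scalar matrix as the
`Q̃`-coefficient). -/
def tupleStackLeftMul {ι : Type*} [Fintype ι] {p : ℕ} (M : Fin p → ι → Matrix (Fin m) (Fin m) k) :
    (ι → Matrix (Fin m) (Fin n) k) →ₗ[k] (Fin p → Matrix (Fin m) (Fin n) k) where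
  toFun W i := ∑ s, M i s * W s
  map_add' A B := by
    funext i
    simp only [Pi.add_apply, Matrix.mul_add, Finset.sum_add_distrib]
  map_smul' c A := by
    funext i
    simp only [Pi.smul_apply, Matrix.mul_smul, RingHom.id_apply, Finset.smul_sum]

/-- `tupleStackLeftMul M W i = ∑ s, M i s * W s`. -/
@[simp] theorem tupleStackLeftMul_apply {ι : Type*} [Fintype ι] {p : ℕ} (M : Fin p → ι → Matrix (Fin m) (Fin m) k)
    (W : ι → Matrix (Fin m) (Fin n) k) (i : Fin p) : tupleStackLeftMul M W i = ∑ s, M i s * W s := rfl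

/-- Tuple-stacked left multiplications commute with componentwise right multiplication. -/
theorem tupleStackLeftMul_mul_right {ι : Type*} [Fintype ι] {p : ℕ} (M : Fin p → ι → Matrix (Fin m) (Fin m) k)
    (g : Matrix (Fin n) (Fin n) k) (hg : IsUnit g.det) (W : ι → Matrix (Fin m) (Fin n) k) :
    tupleStackLeftMul M (fun s => matMulRight g hg (W s)) = stackMulRight p g hg (tupleStackLeftMul (n := n) M W) := by
  funext i
  simp [stackMulRight, Matrix.mul_assoc]

/-- **Matrix tuple systems.** Tuple set `𝓛`, independence on the sub-family `emb`, caps `a` with `κ a` tuple-stacked left-multiplication vectors and fixed summands. -/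
def MatTupleSol {ι ι₀ A : Type*} [Fintype ι] {κ : A → Type*} (𝓛 : Set (ι → Matrix (Fin m) (Fin n) k)) (emb : ι₀ → ι) (p : A → ℕ)
    (M : (a : A) → κ a → Fin (p a) → ι → Matrix (Fin m) (Fin m) k) (Q : (a : A) → Submodule k (Fin (p a) → Matrix (Fin m) (Fin n) k))
    (cap : A → ℕ) : Prop :=
  TupleSol 𝓛 emb (U := fun a => Fin (p a) → Matrix (Fin m) (Fin n) k) (fun a j => tupleStackLeftMul (M a j)) Q cap

/-- **Componentwise right translation by an invertible `g` preserves tuple-level solvability** (tuple set and fixed summands translated). -/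
theorem matTupleSol_iff_image_mul_right {ι ι₀ A : Type*} [Fintype ι] {κ : A → Type*} (𝓛 : Set (ι → Matrix (Fin m) (Fin n) k))
    (emb : ι₀ → ι) (p : A → ℕ) (M : (a : A) → κ a → Fin (p a) → ι → Matrix (Fin m) (Fin m) k)
    (Q : (a : A) → Submodule k (Fin (p a) → Matrix (Fin m) (Fin n) k)) (cap : A → ℕ)
    (g : Matrix (Fin n) (Fin n) k) (hg : IsUnit g.det) :
    MatTupleSol 𝓛 emb p M Q cap ↔
      MatTupleSol ((fun W : ι → Matrix (Fin m) (Fin n) k => fun s => W s * g) '' 𝓛) emb p M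
        (fun a => (Q a).map (stackMulRight (m := m) (p a) g hg).toLinearMap) cap := by
  unfold MatTupleSol
  exact tupleSol_iff_of_linearEquiv (matMulRight g hg) (fun a => stackMulRight (p a) g hg) rfl emb
    (fun a j W => tupleStackLeftMul_mul_right (M a j) g hg W) (fun a => rfl) cap

end MatrixTuple

/-! ## §3 The Q̃-mode ω-lists -/

section OmegaTuple

variable {k : Type*} [Field k] {m n : ℕ}

/-- **The Q̃-mode tuple list of a branch functional `ω`.** Terms `s ≠ q₀` carry the ω-filtered footprint lists `omegaList P (f s) (Φ s) ω` of p529277; the extra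
unknown at `q₀` carries the AFFINE list `{Q ∈ P : ω(Q) = 1}`. -/
def omegaTupleList {ι : Type*} (P : Submodule k (Matrix (Fin m) (Fin n) k)) (f : ι → Module.Dual k (Matrix (Fin m) (Fin m) k))
    (Φ : ι → (Matrix (Fin m) (Fin m) k → k) → Prop) (q₀ : ι) (ω : Module.Dual k (Matrix (Fin m) (Fin n) k)) :
    Set (ι → Matrix (Fin m) (Fin n) k) :=
  {W | (∀ s, s ≠ q₀ → W s ∈ omegaList P (f s) (Φ s) ω) ∧ W q₀ ∈ P ∧ ω (W q₀) = 1}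

/-- **The Q̃-mode lists are carried by the stabiliser:** `(omegaTupleList (ω ∘ (· g)))·g = omegaTupleList ω` for invertible `g` with `P·g ⊆ P`, `P·g⁻¹ ⊆ P`. -/
theorem image_mulRight_omegaTupleList {ι : Type*} (P : Submodule k (Matrix (Fin m) (Fin n) k)) (g : Matrix (Fin n) (Fin n) k)
    (hg : IsUnit g.det) (hP : ∀ W ∈ P, W * g ∈ P) (hP' : ∀ W ∈ P, W * g⁻¹ ∈ P)
    (f : ι → Module.Dual k (Matrix (Fin m) (Fin m) k)) (Φ : ι → (Matrix (Fin m) (Fin m) k → k) → Prop) (q₀ : ι)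
    (ω : Module.Dual k (Matrix (Fin m) (Fin n) k)) :
    (fun W : ι → Matrix (Fin m) (Fin n) k => fun s => W s * g) '' omegaTupleList P f Φ q₀ (dualMulRight ω g hg) =
      omegaTupleList P f Φ q₀ ω := by
  ext W
  constructor
  · rintro ⟨W₀, ⟨hW₀, hQP, hQ1⟩, rfl⟩
    refine ⟨fun s hs => ?_, hP _ hQP, by simpa only [dualMulRight_apply] using hQ1⟩
    have hmem : W₀ s * g ∈ (fun W : Matrix (Fin m) (Fin n) k => W * g) '' omegaList P (f s) (Φ s) (dualMulRight ω g hg) :=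
      ⟨W₀ s, hW₀ s hs, rfl⟩
    rwa [image_mul_right_omegaList P g hg hP hP' (f s) (Φ s) ω] at hmem
  · rintro ⟨hW, hQP, hQ1⟩
    refine ⟨fun s => W s * g⁻¹, ⟨fun s hs => ?_, hP' _ hQP, ?_⟩, ?_⟩
    · have hmem : W s ∈ (fun W : Matrix (Fin m) (Fin n) k => W * g) '' omegaList P (f s) (Φ s) (dualMulRight ω g hg) := by
        rw [image_mul_right_omegaList P g hg hP hP' (f s) (Φ s) ω]; exact hW s hs
      obtain ⟨W₁, hW₁, hW₁eq⟩ := hmem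
      have : W s * g⁻¹ = W₁ := by
        rw [← hW₁eq, Matrix.mul_assoc, Matrix.mul_nonsing_inv g hg, Matrix.mul_one]
      show W s * g⁻¹ ∈ _
      rw [this]; exact hW₁
    · rw [dualMulRight_apply, Matrix.mul_assoc, Matrix.nonsing_inv_mul g hg, Matrix.mul_one]; exact hQ1
    · funext s
      show W s * g⁻¹ * g = W s
      rw [Matrix.mul_assoc, Matrix.nonsing_inv_mul g hg, Matrix.mul_one]

/-- **The Q̃-mode ω-branch system.** -/
def OmegaTupleSol {ι ι₀ A : Type*} [Fintype ι] {κ : A → Type*} (P : Submodule k (Matrix (Fin m) (Fin n) k))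
    (f : ι → Module.Dual k (Matrix (Fin m) (Fin m) k)) (Φ : ι → (Matrix (Fin m) (Fin m) k → k) → Prop) (q₀ : ι) (emb : ι₀ → ι)
    (p : A → ℕ) (M : (a : A) → κ a → Fin (p a) → ι → Matrix (Fin m) (Fin m) k)
    (Q : (a : A) → Submodule k (Fin (p a) → Matrix (Fin m) (Fin n) k)) (cap : A → ℕ) (ω : Module.Dual k (Matrix (Fin m) (Fin n) k)) : Prop :=
  MatTupleSol (omegaTupleList P f Φ q₀ ω) emb p M Q cap

/-- **THE K-EQUIVARIANCE THEOREM for the Q̃-mode system.** For invertible `g` with `P·g ⊆ P`, `P·g⁻¹ ⊆ P` and `g`-stable fixed summands: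
`SOL(ω) ⇔ SOL(ω ∘ (· g))`. -/
theorem omegaTupleSol_iff_comp_mulRight {ι ι₀ A : Type*} [Fintype ι] {κ : A → Type*} (P : Submodule k (Matrix (Fin m) (Fin n) k))
    (f : ι → Module.Dual k (Matrix (Fin m) (Fin m) k)) (Φ : ι → (Matrix (Fin m) (Fin m) k → k) → Prop) (q₀ : ι) (emb : ι₀ → ι)
    (p : A → ℕ) (M : (a : A) → κ a → Fin (p a) → ι → Matrix (Fin m) (Fin m) k)
    (Q : (a : A) → Submodule k (Fin (p a) → Matrix (Fin m) (Fin n) k)) (cap : A → ℕ) (ω : Module.Dual k (Matrix (Fin m) (Fin n) k))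
    (g : Matrix (Fin n) (Fin n) k) (hg : IsUnit g.det) (hP : ∀ W ∈ P, W * g ∈ P) (hP' : ∀ W ∈ P, W * g⁻¹ ∈ P)
    (hQ : ∀ a, (Q a).map (stackMulRight (m := m) (p a) g hg).toLinearMap = Q a) :
    OmegaTupleSol P f Φ q₀ emb p M Q cap ω ↔ OmegaTupleSol P f Φ q₀ emb p M Q cap (dualMulRight ω g hg) := by
  unfold OmegaTupleSol
  rw [matTupleSol_iff_image_mul_right (omegaTupleList P f Φ q₀ (dualMulRight ω g hg)) emb p M Q cap g hg,
    image_mulRight_omegaTupleList P g hg hP hP' f Φ q₀ ω]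
  have hQ' : (fun a => (Q a).map (stackMulRight (m := m) (p a) g hg).toLinearMap) = Q := funext hQ
  rw [hQ']

end OmegaTuple

end Summit.MatrixMultiplication.OmegaCensus.SmallFormats
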